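import Summits.QuantumFields.YangMills.Theorems.LuscherReductionTwistedTraceScalingRecordExposed
import Summits.QuantumFields.YangMills.Theorems.LuscherReductionTwistedTraceScalingBOStiffHSTLow
import HarnessLib

/-!
# ★★★ A THIN C4-SHELL AT ANY OUTER EXPONENT `0 < s < 1/5` FROM THE LOW BRICKS: `InnerShellGainSmallAt L (β^{−a}) (β^{−s}) (β^{−q})` ⟸ the (B-OD) brick at exponent `s` with a polynomial rate
# (lane A of S-BASE, crux `TwistedTraceScaling` stmt-QuantumFields-20203, line «twolattice», stub `stub_fixedLatticeTraceLaw`; lead g23; card `pub/ym-fleet/ym-luscher-20007-p1/Lines-shell-gain.md` §4)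

The shell brick list (✓`ShellBricks`, ✓`innerShellGainSmallAt_of_shellBricks`) on the record tube `recordChi L s 43 M` at ANY exponent `0 < s < 1/5`, assembled from bricks that are in the
tree for every such `s`: profile ✓`recordProfile L` and slow factor ✓`recordSigma L` (exponent-free), (B-T)_s ✓`profileB_hT` (rate `κ_s = 2β^{−2s}ℓ⁹`, ✓`rateB_dom`), (B-N) ✓`fibreMass_brick_record` +
✓`fpWeight_core_constant`, (B-ST)_s ✓`hST_record_low` (hand A, `0 < s ≤ 1/3`), supports ✓`boFun_support_record`, shadow/radii ✓`record_structural_inequalities` (`0 < s < 1/5`) with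
✓`eventually_radius_small_B`, admissibility ✓`softTubeAdmissible_recordWeightRho`, FLOOR ✓`record_floor` (from the record at exponent `9/50`, same `recordSigma`), inner shadow and
domination as in ✓`shellBricks_of_boBricks` but with POLYNOMIAL envelopes (`κ_s`, and `b β² ≤ β^{−p}` for every `p < min(2s, 1/3)` — the rate conjunct of hand A's `hOD_record_low`).
* ★★★ `innerShellGainSmallAt_record_low (hL2 : 2 ≤ L) (hs0 : 0 < s) (hs5 : s < 1/5) (ha0 : 0 < a) (has : 3a/2 < 2s) (ha5 : a < 1/5) (hOD) (q) :
  InnerShellGainSmallAt L (powScale a) (powScale s) (powScale q)` — the ONLY hypothesis is the (B-OD) brick `hOD` at exponent `s` in the shape of `hOD_record_low`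
  (`∃ M₀, ∀ M ≥ M₀, ∃ b ≥ 0, (∀ p < min(2s,1/3), ∀ᶠ β, b β² ≤ β^{−p}) ∧ ∀ᶠ β, HOD(β, b β, M)`).
With it, the eight hypotheses of ✓`coarseUpper_of_thinShells` are instances (outer exponents `13/100, …, 1/40`, each `3a/2 < 2b`), so COARSE-UPPER(L) follows from `hOD_record_low` alone.
HONEST FRAMING: fixed-lattice assembly for a stub of a child of the CONDITIONAL reduction route R2b1; COARSE-UPPER/LOWER/TAIL, the stubs and the crux stay OPEN; not infinite volume, not a mass
gap, not Clay.  No definitions, no `sorry`.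
(Build touch 2026-08-30T04:0xZ: declarations byte-identical to ✓p758044; docstring line only, to trigger the hub olean build.)
-/

set_option autoImplicit false

noncomputable section

open MeasureTheory Filter Topology Real
open scoped BigOperators
open Literature.MathematicalPhysics.QuantumFieldTheory
open Literature.MathematicalPhysics.QuantumLattice

namespace Summit.QuantumFields.YangMills.Theorems.FemtoTransferGap.TwoLattice.ConstTube

open Summit.QuantumFields.YangMills.Theorems.FemtoTransferGap
open Summit.QuantumFields.YangMills.Theorems.FemtoTransferGap.TwoLattice
open Summit.QuantumFields.YangMills.Theorems.FemtoTransferGap.TwoLattice.Avg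
open Summit.QuantumFields.YangMills.Theorems.FemtoTransferGap.TwoLattice.Stiff (LinkSpace)

variable {L : ℕ} [NeZero L]

/-- Polynomial domination bookkeeping: `ε·β^{−p}·ℓ^k ≤ β^{−p'}` eventually whenever `p' < p` — in the form `C·(powScale p β·btLog β^k) ≤ powScale p' β / D`. [folklore] -/
theorem eventually_powScale_log_le {p p' C D : ℝ} (hpp : p' < p) (hD : 0 < D) (k : ℕ) :
    ∀ᶠ β : ℝ in atTop, C * (powScale p β * btLog β ^ k) ≤ powScale p' β / D := by
  by_cases hC : C ≤ 0
  · filter_upwards with β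
    have h1 : C * (powScale p β * btLog β ^ k) ≤ 0 :=
      mul_nonpos_of_nonpos_of_nonneg hC (mul_nonneg (powScale_pos p β).le (pow_nonneg (zero_le_one.trans (one_le_btLog β)) k))
    have h2 : 0 ≤ powScale p' β / D := div_nonneg (powScale_pos p' β).le hD.le
    linarith
  · push Not at hC
    have ht := tendsto_powScale_mul_btLog_pow (p := p - p') (by linarith) k
    have hpos : (0 : ℝ) < 1 / (C * D) := by positivity
    filter_upwards [ht.eventually (eventually_le_nhds hpos)] with β hβ
    have e : powScale p β = powScale p' β * powScale (p - p') β := by rw [powScale_mul_powScale]; ring_nf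
    rw [e]
    have hp' := powScale_pos p' β
    have h1 : C * D * (powScale (p - p') β * btLog β ^ k) ≤ 1 := by
      have := mul_le_mul_of_nonneg_left hβ (show (0 : ℝ) ≤ C * D by positivity)
      have e2 : C * D * (1 / (C * D)) = 1 := by field_simp
      linarith only [this, e2]
    rw [le_div_iff₀ hD]
    nlinarith only [h1, hp', hC, hD]

set_option maxHeartbeats 1600000 in
-- large record expressions and a long structure instance.
/-- ★★★ **A THIN C4-SHELL WITH OUTER EXPONENT `s ∈ (0, 1/5)` FROM THE (B-OD) BRICK AT `s`** (see the module docstring). [cite: Luscher1983, §3] [cite: SjostrandZworski2007, §2] -/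
theorem innerShellGainSmallAt_record_low (hL2 : 2 ≤ L) {s a : ℝ} (hs0 : 0 < s) (hs5 : s < 1 / 5) (ha0 : 0 < a) (has : 3 * a / 2 < 2 * s) (ha5 : a < 1 / 5)
    (hODin : ∃ M₀ : ℝ, ∀ M : ℝ, M₀ ≤ M → ∃ b : ℝ → ℝ, (∀ β, 0 ≤ b β) ∧ (∀ p : ℝ, p < 2 * s → p < 1 / 3 → ∀ᶠ β : ℝ in atTop, b β ^ 2 ≤ powScale p β) ∧
      ∀ᶠ β : ℝ in atTop, ∀ (φ : GaugeConfig 3 1 SU2 → ℝ) (v : GaugeConfig 3 L SU2 → ℝ), Measurable φ → (∃ C : ℝ, ∀ u, |φ u| ≤ C) →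
        (∀ u, φ u ≠ 0 → orbitDist u < recordDelta1 L s β) → Measurable v → (∃ C : ℝ, ∀ U, |v U| ≤ C) → (∀ U, v U ≠ 0 → recordChi L s 43 M β U ≠ 0) →
        (∀ u, fibreInner L (softWeight (recordChi L s 43 M β)) (recordProfile L β) v u = 0) →
        |tubeCross β (boFun L φ (recordProfile L β)) v| ≤ b β * (recordSigma L β * levelValue su2Rep 1 ((L : ℝ) ^ 3 * β) 0) *
            Real.sqrt (tubeNormSq (softWeight (recordChi L s 43 M β)) (boFun L φ (recordProfile L β))) * Real.sqrt (tubeNormSq (softWeight (recordChi L s 43 M β)) v) ∧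
        |tubeCross β v (boFun L φ (recordProfile L β))| ≤ b β * (recordSigma L β * levelValue su2Rep 1 ((L : ℝ) ^ 3 * β) 0) *
            Real.sqrt (tubeNormSq (softWeight (recordChi L s 43 M β)) (boFun L φ (recordProfile L β))) * Real.sqrt (tubeNormSq (softWeight (recordChi L s 43 M β)) v))
    (q : ℝ) : InnerShellGainSmallAt L (powScale a) (powScale s) (powScale q) := by
  have hLz : Nonempty (NzSite L) := nonempty_nzSite_of_two_le hL2
  have hs3 : s ≤ 1 / 3 := by linarith
  have hs4 : s ≤ 1 / 4 := by linarith
  have hs2 : s < 1 / 2 := by linarith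
  have hE : (0 : ℝ) < Fintype.card (Edge 3 L) := by exact_mod_cast Fintype.card_pos
  have hL0 : (0 : ℝ) < L := by exact_mod_cast Nat.pos_of_ne_zero (NeZero.ne L)
  -- the profile
  obtain ⟨hΩm, hΩ1, hΩ0, hΩinv, hΩr, hI, hγ⟩ := recordProfile_props (L := L)
  set rB : ℝ → ℝ := fun β => min (1 / 40) (powScale (1 / 2) β * btLog β) with hrBdef
  have hr : ∀ β, 0 < rB β ∧ rB β ≤ 1 / 40 ∧ rB β ≤ powScale (1 / 2) β * btLog β := fun β =>
    ⟨lt_min (by norm_num) (mul_pos (powScale_pos _ _) (lt_of_lt_of_le one_pos (one_le_btLog β))), min_le_left _ _, min_le_right _ _⟩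
  have hr' : ∀ β, 0 ≤ rB β ∧ rB β ≤ powScale (1 / 2) β * btLog β := fun β => ⟨(hr β).1.le, (hr β).2.2⟩
  have hr2 : ∀ β, 0 ≤ rB β ∧ rB β ≤ 1 / 2 := fun β => ⟨(hr β).1.le, by linarith [(hr β).2.1]⟩
  have hΩrB : ∀ β (x : LinkSpace L), recordProfile L β x ≠ 0 → ‖x‖ ≤ rB β := fun β x hx => hΩr β x hx
  have hΩt : ∀ β (v : Edge 3 L → Fin 3 → ℝ), recordProfile L β (linkEmbed L v) ≠ 0 → (∀ (e : Edge 3 L) (c : Fin 3), |v e c| ≤ rB β) ∧ ‖linkEmbed L v‖ ≤ rB β := by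
    intro β v hv
    have h := hΩr β _ hv
    exact ⟨fun e c => by
      have := Summit.QuantumFields.YangMills.Theorems.FemtoTransferGap.TwoLattice.Cov.abs_apply_le_norm (linkEmbed L v) e c
      rw [linkEmbed_apply] at this; exact this.trans h, h⟩
  -- (B-T) at exponent `s`, structural inequalities, (B-ST), (B-OD), the FP sandwich
  have hTp := profileB_hT (L := L) hs0 hs4 hΩm hΩ1 hΩ0 hΩinv hr hΩt hγ
  have hr_small := eventually_radius_small_B (L := L) hs2 hr'
  obtain ⟨hδ₁, -, hradii, hshadowK⟩ := record_structural_inequalities (L := L) hs0 hs5 hr_small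
  obtain ⟨M_ST, hM_ST, HST⟩ := hST_record_low (L := L) hLz hL2 hs0 hs3
  obtain ⟨M_OD, HOD⟩ := hODin
  have hδ0 : ∀ β, 0 < 43 * powScale s β := fun β => mul_pos (by norm_num) (powScale_pos s β)
  have hδt : Tendsto (fun β => 43 * powScale s β) atTop (𝓝 0) := by
    have := (tendsto_powScale hs0).const_mul 43; simpa using this
  have hsd : ∀ᶠ β in atTop, 0 < powScale 1 β ∧ powScale 1 β ≤ (43 * powScale s β) ^ 3 := by
    filter_upwards [Filter.eventually_ge_atTop (1 : ℝ)] with β hβ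
    refine ⟨powScale_pos 1 β, (powScale_one_le_cube (σ := s) hs3 hβ).trans ?_⟩
    have hp := powScale_pos s β
    have h1 : powScale s β ≤ 43 * powScale s β := by nlinarith
    exact pow_le_pow_left₀ hp.le h1 3
  obtain ⟨M₁, hM₁, hPM⟩ := fpWeight_core_constant L hLz hδ0 hδt hsd
  set M : ℝ := max (max M_ST M_OD) (max M₁ 2)
  have hM2 : 2 ≤ M := (le_max_right _ _).trans (le_max_right _ _)
  have hM0 : 0 ≤ M := by linarith
  obtain ⟨θ₀, hθ₀, hST⟩ := HST M ((le_max_left _ _).trans (le_max_left _ _))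
  obtain ⟨brate, hb0, hbenv, hOD⟩ := HOD M ((le_max_right _ _).trans (le_max_left _ _))
  obtain ⟨C, β₀, -, hP⟩ := hPM M ((le_max_left _ _).trans (le_max_right _ _))
  have hshadow := hshadowK 43 M (by norm_num) hM0
  -- the slow factor, positive everywhere
  set σ : ℝ → ℝ := fun β => if 0 < recordSigma L β then recordSigma L β else 1 with hσdef
  have hσpos : ∀ β, 0 < σ β := fun β => by
    rw [hσdef]; dsimp only; split_ifs with h
    · exact h
    · exact one_pos
  have hσeq : ∀ᶠ β : ℝ in atTop, σ β = recordSigma L β :=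
    (eventually_ge_atTop (0 : ℝ)).mono fun β hβ => by rw [hσdef]; dsimp only; rw [if_pos (recordSigma_pos hβ)]
  -- the one-site radius exponent
  set c : ℝ := (a + min (1 / 5) (4 * s / 3)) / 2 with hcdef
  have hmin5 : min (1 / 5 : ℝ) (4 * s / 3) ≤ 1 / 5 := min_le_left _ _
  have hmins : min (1 / 5 : ℝ) (4 * s / 3) ≤ 4 * s / 3 := min_le_right _ _
  have hamin : a < min (1 / 5 : ℝ) (4 * s / 3) := lt_min ha5 (by linarith)
  have hc0 : 0 < c := by rw [hcdef]; linarith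
  have hca : 0 < c - a := by rw [hcdef]; linarith
  have hc5 : c < 1 / 5 := by rw [hcdef]; linarith
  have hcs : 3 * c / 2 < 2 * s := by rw [hcdef]; linarith
  have hc3 : 3 * c / 2 < 1 / 3 := by linarith
  -- eventual comparisons of the radii (inner shadow)
  have hra : ∀ᶠ β : ℝ in atTop, 16 * (Fintype.card (Edge 3 L) : ℝ) * rB β ≤ powScale a β := by
    have h := eventually_powScale_log_le (C := 16 * (Fintype.card (Edge 3 L) : ℝ)) (p := 1 / 2) (p' := a) (by linarith) one_pos 1
    filter_upwards [h] with β hβ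
    rw [pow_one, div_one] at hβ
    exact le_trans (mul_le_mul_of_nonneg_left (hr β).2.2 (by positivity)) hβ
  have hcrad : ∀ᶠ β : ℝ in atTop, 24 * (Fintype.card (Edge 3 L) : ℝ) * powScale c β ≤ powScale a β := by
    have h := eventually_powScale_log_le (C := 24 * (Fintype.card (Edge 3 L) : ℝ)) (p := c) (p' := a) (by linarith) one_pos 0
    filter_upwards [h] with β hβ
    rw [pow_zero, mul_one, div_one] at hβ
    exact hβ
  -- admissibility of the record weight
  have hadm : SoftTubeAdmissible L (powScale s) (recordChi L s 43 M) :=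
    softTubeAdmissible_mono (fun β => by have := powScale_pos s β; show powScale s β ≤ 43 * powScale s β; nlinarith)
      (softTubeAdmissible_recordWeightRho L hδ0 (fun β => by
        have : 0 ≤ 43 * powScale s β := (hδ0 β).le
        show 2 * (43 * powScale s β) ≤ M * (43 * powScale s β); nlinarith))
  obtain ⟨hθ0, hθ1⟩ := hθ₀
  -- the brick list
  refine innerShellGainSmallAt_of_shellBricks hs0
    { Ω := recordProfile L
      𝒰 := fun β => {u | orbitDist u < recordDelta1 L s β}
      σ := σ
      γ := recordGamma L (recordProfile L)
      κ := fun β => 2 * (powScale (2 * s) β * btLog β ^ 9)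
      b := brate
      t := powScale c
      δ₁ := recordDelta1 L s
      θ₀ := θ₀
      hadm := hadm
      hwm := fun β => (softWeight_recordChi_props s 43 M β).1
      hwb := fun β => ⟨_, (softWeight_recordChi_props s 43 M β).2.1⟩
      hw0 := fun β => (softWeight_recordChi_props s 43 M β).2.2.1
      hwinv := fun β => (softWeight_recordChi_props s 43 M β).2.2.2
      hΩm := hΩm
      hΩ1 := hΩ1
      hΩinv := hΩinv
      h𝒰m := fun β => measurableSet_lt measurable_orbitDist measurable_const
      h𝒰inv := fun β g u => by simp only [Set.mem_setOf_eq, orbitDist_gaugeTransform]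
      h𝒰δ₁ := fun β u hu => hu
      hδ₁ := hδ₁
      hshadow := by filter_upwards [hshadow] with β hβ U hU hd; exact hβ U hU hd
      hshadowIn := ?_
      hbo := ?_
      ht := ?_
      hσ := hσpos
      hγ := hγ
      hκ := fun β => rateB_nonneg s β
      hb := hb0
      hθ₀ := ⟨hθ0, hθ1⟩
      hfloor := by filter_upwards [record_floor (L := L) hL2, hσeq] with β h he; rw [he]; exact h
      hdom := ?_
      hN := ?_
      hT := by filter_upwards [hTp, hσeq] with β h he φ h1 h2 h3 h4; rw [he]; exact h φ h1 h2 h3 h4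
      hST := by filter_upwards [hST, hσeq] with β h he; rw [he]; exact h
      hOD := by filter_upwards [hOD, hσeq] with β h he; rw [he]; exact h }
  · -- inner shadow
    filter_upwards [hra, hcrad] with β hra hca
    intro u v _ hΩ hdist
    by_contra hlt
    push Not at hlt
    have hve : ∀ e, ‖v e‖ ≤ rB β := fun e => (norm_apply_le_norm_linkEmbed v e).trans (hΩrB β _ hΩ)
    have h := orbitDist_orthoTube_le (L := L) hlt.le (hr2 β).2 hve
    have h1 : (Fintype.card (Edge 3 L) : ℝ) * (4 * rB β) ≤ powScale a β / 4 := by nlinarith only [hra, hE]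
    have h2 : (Fintype.card (Edge 3 L) : ℝ) * (6 * powScale c β) ≤ powScale a β / 4 := by nlinarith only [hca, hE]
    have h3 : (Fintype.card (Edge 3 L) : ℝ) * (4 * rB β + 6 * powScale c β) ≤ powScale a β / 2 := by nlinarith only [h1, h2]
    linarith only [h, h3, hdist]
  · -- BO supports
    filter_upwards [hradii] with β hrad φ U hφ hU
    have hpos : 0 ≤ 4 * rB β + recordDelta1 L s β := by
      by_contra h; push Not at h
      obtain ⟨-, hφU, -⟩ := boFun_ne_zero L hU
      have h1 := hφ _ hφU; have h2 := orbitDist_nonneg (slowMean L U); linarith [(hr2 β).1, h1, h2]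
    have hcard1 : (1 : ℝ) ≤ Fintype.card (Edge 3 L) := by exact_mod_cast Fintype.card_pos
    have hρ : 4 * rB β + recordDelta1 L s β < M * (43 * powScale s β) := by
      have h1 : 4 * rB β + recordDelta1 L s β ≤ (Fintype.card (Edge 3 L) : ℝ) * (4 * rB β + recordDelta1 L s β) := by nlinarith
      have h2 : 43 * powScale s β ≤ M * (43 * powScale s β) := by have := powScale_pos s β; nlinarith
      linarith
    exact (boFun_support_record (δ' := fun β => 43 * powScale s β) (ρ := fun b => M * (43 * powScale s b)) (δg := powScale 1) hφ (hr2 β).2 (hΩrB β) hρ hrad hU).1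
  · -- the one-site radius window
    have hL1 : (1 : ℝ) ≤ (L : ℝ) ^ 3 := one_le_pow₀ (by exact_mod_cast NeZero.one_le)
    obtain ⟨β₅, h₅⟩ := powScale_eventually_le hc0 (show (0 : ℝ) < 1 / 5000 by norm_num)
    filter_upwards [Filter.eventually_ge_atTop (max 1 β₅)] with β hβ
    have hβ1 : 1 ≤ β := (le_max_left _ _).trans hβ
    have hβ0 : 0 < β := by linarith only [hβ1]
    refine ⟨?_, h₅ β ((le_max_right _ _).trans hβ)⟩
    have h1 : ((L : ℝ) ^ 3 * β) ^ (-(1 / 5 : ℝ)) ≤ β ^ (-(1 / 5 : ℝ)) := by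
      rw [Real.rpow_neg (by positivity), Real.rpow_neg hβ0.le]
      exact inv_anti₀ (Real.rpow_pos_of_pos hβ0 _) (Real.rpow_le_rpow hβ0.le (by nlinarith only [hL1, hβ0]) (by norm_num))
    rw [← powScale_eq hβ1] at h1
    exact h1.trans (powScale_le_powScale hc5.le β)
  · -- domination with polynomial envelopes
    intro A
    obtain ⟨βg, hg⟩ := powScale_dominates_bareLambda (L := L) hc3 (240 * |A|)
    obtain ⟨βθ, hθ⟩ := powScale_dominates_bareLambda (L := L) (show (0 : ℝ) < 1 / 3 by norm_num) (2 * (|A| + 1) / θ₀)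
    set p₁ : ℝ := (3 * c / 2 + min (2 * s) (1 / 3)) / 2 with hp₁
    have hp₁lt : p₁ < 2 * s := by rw [hp₁]; have := min_le_left (2 * s) (1 / 3 : ℝ); linarith
    have hp₁lt3 : p₁ < 1 / 3 := by rw [hp₁]; have := min_le_right (2 * s) (1 / 3 : ℝ); linarith
    have hp₁gt : 3 * c / 2 < p₁ := by rw [hp₁]; have := lt_min hcs hc3; linarith
    have hκev := eventually_powScale_log_le (C := (12 : ℝ)) (p := 2 * s) (p' := 3 * c / 2) hcs (show (0 : ℝ) < 240 by norm_num) 9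
    have hbev := eventually_powScale_log_le (C := 2 / θ₀) (p := p₁) (p' := 3 * c / 2) hp₁gt (show (0 : ℝ) < 240 by norm_num) 0
    filter_upwards [Filter.eventually_ge_atTop (max (max 1 βg) βθ), hbenv p₁ hp₁lt hp₁lt3, hκev, hbev] with β hβ hb2 hκ hbb
    have hβ1 : 1 ≤ β := ((le_max_left _ _).trans (le_max_left _ _)).trans hβ
    have hβ0 : 0 < β := by linarith only [hβ1]
    have hL1 : (1 : ℝ) ≤ (L : ℝ) ^ 3 := one_le_pow₀ (by exact_mod_cast NeZero.one_le)
    have hB0 : 0 < (L : ℝ) ^ 3 * β := by nlinarith only [hL1, hβ0]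
    have hlam0 : 0 < bareLambda ((L : ℝ) ^ 3 * β) := bareLambda_pos' hB0
    have hA : A * bareLambda ((L : ℝ) ^ 3 * β) ≤ |A| * bareLambda ((L : ℝ) ^ 3 * β) := mul_le_mul_of_nonneg_right (le_abs_self A) hlam0.le
    have hsq : Real.sqrt (powScale c β) = powScale (c / 2) β := by
      unfold powScale
      rw [Real.sqrt_eq_rpow, ← Real.rpow_mul (by positivity)]
      ring_nf
    have htt : powScale c β * Real.sqrt (powScale c β) = powScale (3 * c / 2) β := by
      rw [hsq, powScale_mul_powScale]; ring_nf
    constructor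
    · rw [htt]
      have h1 := hg β (((le_max_right _ _).trans (le_max_left _ _)).trans hβ)
      have hP := powScale_pos (3 * c / 2) β
      -- the three pieces, each `≤ powScale (3c/2) β / 240`
      have hk : 6 * (2 * (powScale (2 * s) β * btLog β ^ 9)) ≤ powScale (3 * c / 2) β / 240 := by
        have e : 6 * (2 * (powScale (2 * s) β * btLog β ^ 9)) = 12 * (powScale (2 * s) β * btLog β ^ 9) := by ring
        rw [e]; exact hκ
      have hbt : 2 * brate β ^ 2 / θ₀ ≤ powScale (3 * c / 2) β / 240 := by
        rw [pow_zero, mul_one] at hbb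
        have h2 : 2 * brate β ^ 2 / θ₀ ≤ 2 / θ₀ * powScale p₁ β := by
          rw [div_eq_mul_inv, div_eq_mul_inv]
          have := mul_le_mul_of_nonneg_left hb2 (show 0 ≤ 2 * θ₀⁻¹ by positivity)
          nlinarith only [this]
        exact h2.trans hbb
      have hAt : |A| * bareLambda ((L : ℝ) ^ 3 * β) ≤ powScale (3 * c / 2) β / 240 := by
        have : 240 * |A| * bareLambda ((L : ℝ) ^ 3 * β) ≤ powScale (3 * c / 2) β := h1
        linarith only [this]
      linarith only [hA, hk, hbt, hAt, hP]
    · have h1 := hθ β ((le_max_right _ _).trans hβ)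
      have hp1 : powScale 0 β ≤ 1 := powScale_le_one le_rfl β
      have h2 : 2 * (|A| + 1) / θ₀ * bareLambda ((L : ℝ) ^ 3 * β) ≤ 1 := h1.trans hp1
      have h3 : 2 * (|A| + 1) * bareLambda ((L : ℝ) ^ 3 * β) ≤ θ₀ := by
        have := mul_le_mul_of_nonneg_right h2 hθ0.le
        rw [one_mul] at this
        have e : 2 * (|A| + 1) / θ₀ * bareLambda ((L : ℝ) ^ 3 * β) * θ₀ = 2 * (|A| + 1) * bareLambda ((L : ℝ) ^ 3 * β) := by field_simp
        linarith only [this, e]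
      nlinarith only [hA, h3, hlam0, abs_nonneg A]
  · -- (B-N) fibre mass from (P)
    filter_upwards [hradii, rateB_dom s C, Filter.eventually_ge_atTop β₀] with β hrad hκC hβ u hu
    have hu' : orbitDist u ≤ recordDelta1 L s β := le_of_lt hu
    have hcard1 : (1 : ℝ) ≤ Fintype.card (Edge 3 L) := by exact_mod_cast Fintype.card_pos
    have hpos : 0 ≤ 4 * rB β + recordDelta1 L s β := by have := orbitDist_nonneg u; linarith [(hr2 β).1]
    have hρ : 4 * rB β + recordDelta1 L s β < M * (43 * powScale s β) := by
      have h1 : 4 * rB β + recordDelta1 L s β ≤ (Fintype.card (Edge 3 L) : ℝ) * (4 * rB β + recordDelta1 L s β) := by nlinarith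
      have h2 : 43 * powScale s β ≤ M * (43 * powScale s β) := by have := powScale_pos s β; nlinarith
      linarith
    have hfib : ∀ v ∈ capBalancedSet L, recordProfile L β (linkEmbed L v) ≠ 0 →
        orthoTube L u v ∈ fatTubeRho L (fun β => 43 * powScale s β) (fun b => M * (43 * powScale s b)) β :=
      fun v _ hv => orthoTube_mem_fatTubeRho (δ' := fun β => 43 * powScale s β) (ρ := fun b => M * (43 * powScale s b)) hu' (hr2 β).2 (hΩrB β) hρ hrad v hv
    have h := fibreMass_brick_record (fun β => 43 * powScale s β) (fun b => M * (43 * powScale s b)) (powScale 1) β (hP β hβ) (hΩm β) (hΩ1 β) (hΩrB β) hfib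
    have hγ0 : 0 ≤ recordGamma L (recordProfile L) β := (hγ β).le
    refine h.trans ?_
    show C * (43 * powScale s β) ^ 2 * recordGamma L (recordProfile L) β ≤ 2 * (powScale (2 * s) β * btLog β ^ 9) * recordGamma L (recordProfile L) β
    exact mul_le_mul_of_nonneg_right hκC hγ0

end Summit.QuantumFields.YangMills.Theorems.FemtoTransferGap.TwoLattice.ConstTube

end
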